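/-
Copyright (c) 2026 the pub-hodgecm-mathlib formalisation cell (harness21).  Prover seat hodgecm-mathlib-K2E1-p04 (g2), Track B ∕ K2-LIT
(build stream 29), h413 = `stmt-HodgeConjecture-24833`, line `K2_E1_TraceFormulaBeta`; BY-NAME DEAL of the dealer K2E1-plan (g0)
2026-09-03T22:19:11Z: `Theorems/K2E1SupercuspidalCoefficientNCuspidal.lean` (the LOCAL input instantiating rung 2 (ii) of 5R route S2 on `U(Φ₂)(L⁺_v)`).
-/
import Literature.NumberTheory.Automorphic.U3SupercuspFormUnipotentIntegral   -- ★ generic §1: `integral_dual_apply_eq_zero_of_mem_span_of_exhaustion`, `isLocallyConstant_dual_apply_mul_subgroup`; the N = 3 model (§2–§3 there)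
import Literature.NumberTheory.Automorphic.AdmissibleInvariantFormSchur      -- ★ `IsSupercuspidal.hasCompactSupport_sesqForm_apply_apply`, `LinearMap.IsSymm.eq`
import Literature.NumberTheory.Automorphic.UnitaryGroupBorelInduction        -- ★ `cmBorelTriple`, `unipotentU`, `cmDatum_Local_eq` (the `U(Φ_N)(L⁺_v)` reading)
import Mathlib.MeasureTheory.Integral.Bochner.ContinuousLinearMap            -- `integral_conj`
import HarnessLib

/-!
# K2·E1 — `K2E1SupercuspidalCoefficientNCuspidal`: matrix coefficients of a supercuspidal representation are `N`-CUSPIDAL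
# (`∫_N B (ρ(x n y) u) u' dn = 0`), hence so is the normalised idempotent `e = λ⁻¹ B(ρ(·)u) u` — the local input of rung 2 (ii) of socket 5R

Track B ∕ K2-LIT, crux h413 = `stmt-HodgeConjecture-24833`, route of record `HCCMUnconditional`; cell `hodgecm-mathlib`, squad K2; prover seat
`hodgecm-mathlib-K2E1-p04` (g2), BY-NAME DEAL of the dealer K2E1-plan (g0) 2026-09-03T22:19:11Z; lane `--supports stmt-HodgeConjecture-24833 --as helper`
(count-neutral).  THEOREMS ONLY (no `def`, no `instance`, no notation, no named-fact hypothesis, no `sorry`).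

THE MATHEMATICS [HarishChandra1970 Part I §3: «a continuous `f` is a SUPERCUSP FORM if (i) `Supp f` is compact mod `Z` and (ii) `f^P(x) = ∫_N f(xn) dn = 0`
for every `P ≠ G`»; Thm.: matrix coefficients of supercuspidal representations are supercusp forms; Casselman1995 Thm. 5.3.1; GelfandGraevPiatetskiShapiro1969
Ch. 1 §4].  For a smooth `ρ` on `V`, a subgroup `N ≤ G` with a right-invariant measure `μ` finite on compacta and EXHAUSTED by an increasing sequence of compact
open subgroups `N_j`, and a vector `w ∈ V(N) = ⟨ρ(n)x − x⟩`, Jacquet's first lemma gives `∫_N φ(ρ(a n) w) dμ = 0` for every linear form `φ` whenever the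
integral converges absolutely — THIS IS ★ (`integral_dual_apply_eq_zero_of_mem_span_of_exhaustion`, generic `G`, `U3SupercuspFormUnipotentIntegral` §1).
If `V(N) = V` (VANISHING OF THE JACQUET MODULE `V_N`), every two-sided coefficient `n ↦ φ(ρ(x n y) u)` qualifies (`w := ρ(y) u`), and for a SUPERCUSPIDAL `ρ`
(★ `Representation.IsSupercuspidal`) of a group with COMPACT CENTRE restricted to a CLOSED `N` the integrals converge (compactly supported, locally constant).

SURVEY-FIRST VERDICT (dealer's rule; what is and is not ★).  ★ `Representation.IsSupercuspidal` (`MatrixCoefficients` :273) is Harish-Chandra's condition (i)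
ALONE («smooth matrix coefficients supported in `C · Z(G)`»; the cusp condition (ii) is dropped by design).  The implication «supercuspidal ⇒ `V_N = 0`» is ★
for the quasi-split `U(3)` (`UnitaryGroup.coinvariants_subsingleton_of_isSupercuspidal`, `U3SupercuspidalJacquetVanishing`: Casselman's Haar-free argument
with the Φ₃-specific torus family `d(ϖ^j, 1, ϖ^{-j})` and Iwahori factorisation) and for `GL_n` (★ `coinvariantsKer_eq_top_of_isSupercuspidal`), and the
exhaustion of `N` by compact open subgroups is ★ for the Heisenberg `N ≤ U(σ, Φ₃)` (`exists_compactOpen_subgroups_exhausting_unipotentU_three`); NEITHER is ★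
for `U(Φ₂)`.  Accordingly — as the deal instructs («else take «`N_v`-cuspidal coefficients» as the typed conclusion FROM an explicit Jacquet-vanishing hypothesis
and say so») — this file takes the JACQUET VANISHING (`hJ : ∀ w, w ∈ ⟨ρ(n)x − x⟩`) and the EXHAUSTION (`Nj`) as EXPLICIT HYPOTHESES, generic in `G` and `N`,
and records the `U(Φ_N)(L⁺_v)` ∕ `N = (cmBorelTriple L N v).N` reading; for `N = 3` both hypotheses are ★ theorems (cited), for `N = 2` they are the two
remaining LOCAL letters of 5R route S2 (their proofs are the Φ₂-twins of the cited Φ₃ files: torus `d(ϖ^j, ϖ^{-j}) ∈ U(Φ₂)`, contraction of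
`N = {u(b) : b + b̄ = 0}` by `ϖ^{2j}`).

CONTENT (all on `↥N` with `[MeasurableSpace ↥N] [BorelSpace ↥N]`, `μ` right-invariant and finite on compacts):
* §1 generic `G`: `integral_dual_apply_translate_eq_zero` (`∫ φ(ρ(x n y) u) dμ = 0`, two-sided form of the ★ lemma); sesquilinear `B : V →ₗ⋆[ℂ] V →ₗ[ℂ] ℂ`:
  `integral_sesqForm_apply_translate_eq_zero` (`∫ B u' (ρ(x n y) u) dμ = 0`), `integral_sesqForm_translate_apply_eq_zero` (first slot, `B` Hermitian:
  `∫ B (ρ(x n y) u) u' dμ = 0`); AUTOMATIC INTEGRABILITY for `ρ` supercuspidal, `Z(G)` compact, `N` closed, `B` `G`-invariant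
  (`hasCompactSupport_sesqForm_apply_translate_restrict`, `integrable_sesqForm_apply_translate_restrict`, and the first-slot twins); the HEADS
  **`integral_sesqForm_apply_translate_eq_zero_of_isSupercuspidal`** ∕ **`integral_sesqForm_translate_apply_eq_zero_of_isSupercuspidal`** (no integrability
  hypothesis left); and the dealt COROLLARY **`integral_idempotent_translate_eq_zero`**: for any `e : G → ℂ` with `e g = c · B (ρ g u) u` (K2E1-p06 (g2)'s ★ p855188
  normalised idempotent, `c = λ⁻¹`), `∀ x y, ∫ n, e (x n y) dμ = 0` — EXACTLY the hypothesis shape `hcusp` of ★ p855202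
  `K2E1PoincareSeriesConstantTerm.setIntegral_tsum_eq_zero_of_forall_integral_eq_zero` read on `N` (push `μ` into `G` along `N ↪ G` to match it literally).
* §2 the reading on `G_v = U(Φ_N)(L⁺_v) = ↥(unitaryGroupOfForm (conjLocal L c v) (cmLocalForm L N v))` (★ `cmDatum_Local_eq`: this IS `(cmDatum L N Φ_N).Local v`),
  `N_v = (cmBorelTriple L N v).N = unipotentU` (the unipotent radical of the upper-triangular Borel [Rogawski1990 §1.10 p. 9]): `isClosed_coe_cmBorelTriple_N` and the
  head **`UnitaryGroup.integral_idempotent_translate_cmBorelN_eq_zero`** (any `N`, hypotheses `hJ`, `Nj`, `hZ` explicit).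
NOT HERE: the proofs of `hJ` and of the exhaustion for `U(Φ₂)` (see above); the product decomposition `N(𝔸) ≃ N_v × N^v` composing this with ★ p855202 (left to
the assembly node, K2E1-p06 (g2)).

HONEST LABEL: HC_CM is proved only modulo the 7 printed citations (2 remaining named inputs: hLiu418 = `stmt-HodgeConjecture-24832`, h413 =
`stmt-HodgeConjecture-24833`) until rung 0 closes; this file moves no counter.

## References
* [HarishChandra1970] Harish-Chandra (notes by G. van Dijk), *Harmonic Analysis on Reductive p-adic Groups*, LNM 162 (1970), Part I §3 p. 9 (supercusp forms;
  matrix coefficients of supercuspidal representations).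
* [Casselman1995] W. Casselman, *Introduction to the theory of admissible representations of p-adic reductive groups* (1995), Prop. 1.4.4, Thm. 5.3.1.
* [GelfandGraevPiatetskiShapiro1969] I. M. Gelfand, M. I. Graev, I. I. Piatetski-Shapiro, *Representation theory and automorphic functions* (1969), Ch. 1 §4.
* [Rogawski1990] J. Rogawski, *Automorphic representations of unitary groups in three variables*, Ann. of Math. Stud. 123 (1990), §1.10 p. 9 (`B = MN`),
  §12.2 p. 173, §13.8 p. 218 (i)–(iii).
* [Gelbart1975] S. Gelbart, *Automorphic forms on adele groups*, Ann. of Math. Stud. 83 (1975), §10 p. 153 (10.11), Remark 9.23 p. 140.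
-/

set_option autoImplicit false
-- the mandated namespace repeats the single-problem summit's segment (`HodgeConjecture.HodgeConjecture`)
set_option linter.dupNamespace false

noncomputable section

open MeasureTheory Set Filter Topology
open scoped ComplexConjugate
open Literature.NumberTheory.Automorphic

namespace Summit.HodgeConjecture.HodgeConjecture.Cruxes.H413.K2E1SupercuspidalCoefficientNCuspidal

/-! ## §1 Generic group: `N`-cuspidality of coefficients from Jacquet vanishing + exhaustion -/

section Generic

variable {G V : Type*} [Group G] [TopologicalSpace G] [IsTopologicalGroup G] [T2Space G] [AddCommGroup V] [Module ℂ V]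
  (ρ : Representation ℂ G V) (N : Subgroup G) [MeasurableSpace ↥N] [BorelSpace ↥N]
  (μ : Measure ↥N) [IsFiniteMeasureOnCompacts μ] [μ.IsMulRightInvariant]

/-- **Two-sided coefficients are `N`-cuspidal under Jacquet vanishing.**  `ρ` smooth, `N ≤ G` with a right-invariant measure `μ` finite on compacta, EXHAUSTED by
an increasing sequence `N_j` of compact open subgroups; if the Jacquet module of `ρ` along `N` VANISHES (`hJ`: every vector lies in `V(N) = ⟨ρ(n)x − x⟩`), then
for every linear form `φ`, all `x, y ∈ G`, `u ∈ V`: `∫_N φ(ρ(x n y) u) dμ(n) = 0` whenever the integral converges absolutely (★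
`integral_dual_apply_eq_zero_of_mem_span_of_exhaustion` at `w := ρ(y) u`). [cite: HarishChandra1970, Part I §3 p. 9] [cite: Casselman1995, Thm. 5.3.1] -/
theorem integral_dual_apply_translate_eq_zero (hρ : ρ.IsSmooth)
    (hJ : ∀ w : V, w ∈ Submodule.span ℂ (Set.range fun p : ↥N × V => ρ (p.1 : G) p.2 - p.2))
    (Nj : ℕ → Subgroup ↥N) (hmono : Monotone Nj) (hc : ∀ j, IsCompact (Nj j : Set ↥N)) (ho : ∀ j, IsOpen (Nj j : Set ↥N))
    (hex : ∀ n : ↥N, ∃ j, n ∈ Nj j) (φ : Module.Dual ℂ V) (x y : G) (u : V)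
    (hi : Integrable (fun n : ↥N => φ (ρ (x * n * y) u)) μ) :
    ∫ n : ↥N, φ (ρ (x * n * y) u) ∂μ = 0 := by
  have heq : ∀ n : ↥N, φ (ρ (x * n * y) u) = φ (ρ (x * n) (ρ y u)) := fun n => by
    rw [← Module.End.mul_apply, ← map_mul]
  simp_rw [heq] at hi ⊢
  exact integral_dual_apply_eq_zero_of_mem_span_of_exhaustion ρ N μ hρ (hJ (ρ y u)) Nj hmono hc ho hex φ x hi

variable {B : V →ₗ⋆[ℂ] V →ₗ[ℂ] ℂ}

/-- **Sesquilinear coefficients, linear slot**: `∫_N B u' (ρ(x n y) u) dμ(n) = 0` under the hypotheses of `integral_dual_apply_translate_eq_zero`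
(`φ := B u'`). [cite: HarishChandra1970, Part I §3 p. 9] -/
theorem integral_sesqForm_apply_translate_eq_zero (hρ : ρ.IsSmooth)
    (hJ : ∀ w : V, w ∈ Submodule.span ℂ (Set.range fun p : ↥N × V => ρ (p.1 : G) p.2 - p.2))
    (Nj : ℕ → Subgroup ↥N) (hmono : Monotone Nj) (hc : ∀ j, IsCompact (Nj j : Set ↥N)) (ho : ∀ j, IsOpen (Nj j : Set ↥N))
    (hex : ∀ n : ↥N, ∃ j, n ∈ Nj j) (x y : G) (u u' : V)
    (hi : Integrable (fun n : ↥N => B u' (ρ (x * n * y) u)) μ) :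
    ∫ n : ↥N, B u' (ρ (x * n * y) u) ∂μ = 0 :=
  integral_dual_apply_translate_eq_zero ρ N μ hρ hJ Nj hmono hc ho hex (B u') x y u hi

/-- **Sesquilinear coefficients, conjugate-linear slot** (`B` Hermitian, ★ `LinearMap.IsSymm`: `B (ρ g u) u' = conj (B u' (ρ g u))`):
`∫_N B (ρ(x n y) u) u' dμ(n) = 0` (`integral_conj`). [cite: HarishChandra1970, Part I §3 p. 9] -/
theorem integral_sesqForm_translate_apply_eq_zero (hρ : ρ.IsSmooth) (hBsymm : B.IsSymm)
    (hJ : ∀ w : V, w ∈ Submodule.span ℂ (Set.range fun p : ↥N × V => ρ (p.1 : G) p.2 - p.2))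
    (Nj : ℕ → Subgroup ↥N) (hmono : Monotone Nj) (hc : ∀ j, IsCompact (Nj j : Set ↥N)) (ho : ∀ j, IsOpen (Nj j : Set ↥N))
    (hex : ∀ n : ↥N, ∃ j, n ∈ Nj j) (x y : G) (u u' : V)
    (hi : Integrable (fun n : ↥N => B u' (ρ (x * n * y) u)) μ) :
    ∫ n : ↥N, B (ρ (x * n * y) u) u' ∂μ = 0 := by
  have heq : ∀ n : ↥N, B (ρ (x * n * y) u) u' = conj (B u' (ρ (x * n * y) u)) := fun n => (hBsymm.eq u' (ρ (x * n * y) u)).symm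
  simp_rw [heq]
  rw [integral_conj, integral_sesqForm_apply_translate_eq_zero ρ N μ hρ hJ Nj hmono hc ho hex x y u u' hi, map_zero]

/-! ### Automatic convergence for supercuspidal `ρ`, compact centre, closed `N` -/

omit [T2Space G] [MeasurableSpace ↥N] [BorelSpace ↥N] in
/-- **The restricted coefficient `n ↦ B u' (ρ(x n y) u)` has COMPACT SUPPORT on a closed `N`** for `ρ` supercuspidal of a group with compact centre (★
`IsSupercuspidal.hasCompactSupport_sesqForm_apply_apply` composed with the homeomorphism `g ↦ x g y` and the closed embedding `N ↪ G`).
[cite: HarishChandra1970, Part I §3 p. 9] -/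
theorem hasCompactSupport_sesqForm_apply_translate_restrict (hsc : ρ.IsSupercuspidal) (hZ : IsCompact (Subgroup.center G : Set G))
    (hsm : ρ.IsSmooth) (hBinv : ∀ (g : G) (v w : V), B (ρ g v) (ρ g w) = B v w) (hN : IsClosed (N : Set G)) (x y : G) (u u' : V) :
    HasCompactSupport fun n : ↥N => B u' (ρ (x * n * y) u) := by
  have hG : HasCompactSupport fun g : G => B u' (ρ (x * g * y) u) := by
    have h := hsc.hasCompactSupport_sesqForm_apply_apply hZ hsm hBinv u u'
    have heq : (fun g : G => B u' (ρ (x * g * y) u)) = (fun g : G => B u' (ρ g u)) ∘ ((Homeomorph.mulLeft x).trans (Homeomorph.mulRight y)) := by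
      funext g
      simp only [Function.comp_apply, Homeomorph.trans_apply, Homeomorph.coe_mulLeft, Homeomorph.coe_mulRight]
    rw [heq]
    exact h.comp_homeomorph _
  exact hG.comp_isClosedEmbedding hN.isClosedEmbedding_subtypeVal

omit [T2Space G] [MeasurableSpace ↥N] [BorelSpace ↥N] in
/-- The restricted coefficient is CONTINUOUS (locally constant, ★ `isLocallyConstant_dual_apply_mul_subgroup`). [cite: Casselman1995, Prop. 1.4.4] -/
theorem continuous_sesqForm_apply_translate_restrict (hsm : ρ.IsSmooth) (x y : G) (u u' : V) :
    Continuous fun n : ↥N => B u' (ρ (x * n * y) u) := by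
  have heq : (fun n : ↥N => B u' (ρ (x * n * y) u)) = fun n : ↥N => B u' (ρ (x * n) (ρ y u)) := by
    funext n
    rw [← Module.End.mul_apply, ← map_mul]
  rw [heq]
  exact (isLocallyConstant_dual_apply_mul_subgroup ρ N hsm (B u') x (ρ y u)).continuous

omit [T2Space G] [μ.IsMulRightInvariant] in
/-- **The restricted coefficient is INTEGRABLE on `N`** (continuous with compact support, `μ` finite on compacta): the convergence hypothesis of the vanishing
theorems is automatic for supercuspidal `ρ`, compact centre and closed `N`. [cite: HarishChandra1970, Part I §3 p. 9] -/
theorem integrable_sesqForm_apply_translate_restrict (hsc : ρ.IsSupercuspidal) (hZ : IsCompact (Subgroup.center G : Set G)) (hsm : ρ.IsSmooth)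
    (hBinv : ∀ (g : G) (v w : V), B (ρ g v) (ρ g w) = B v w) (hN : IsClosed (N : Set G)) (x y : G) (u u' : V) :
    Integrable (fun n : ↥N => B u' (ρ (x * n * y) u)) μ :=
  (continuous_sesqForm_apply_translate_restrict ρ N hsm x y u u').integrable_of_hasCompactSupport
    (hasCompactSupport_sesqForm_apply_translate_restrict ρ N hsc hZ hsm hBinv hN x y u u')

/-- **HEAD (linear slot): for a SUPERCUSPIDAL `ρ` (compact centre) with vanishing Jacquet module along a closed, exhausted `N`, EVERY two-sided coefficient is
`N`-cuspidal**: `∀ x y u u', ∫_N B u' (ρ(x n y) u) dμ = 0` — Harish-Chandra's «matrix coefficients of supercuspidal representations are supercusp forms», cusp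
condition (ii), with the two inputs the tree does not hold for `U(Φ₂)` (Jacquet vanishing, exhaustion) as hypotheses. [cite: HarishChandra1970, Part I §3 p. 9]
[cite: Casselman1995, Thm. 5.3.1] [cite: GelfandGraevPiatetskiShapiro1969, Ch. 1 §4] -/
theorem integral_sesqForm_apply_translate_eq_zero_of_isSupercuspidal (hsc : ρ.IsSupercuspidal) (hZ : IsCompact (Subgroup.center G : Set G))
    (hsm : ρ.IsSmooth) (hBinv : ∀ (g : G) (v w : V), B (ρ g v) (ρ g w) = B v w) (hN : IsClosed (N : Set G))
    (hJ : ∀ w : V, w ∈ Submodule.span ℂ (Set.range fun p : ↥N × V => ρ (p.1 : G) p.2 - p.2))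
    (Nj : ℕ → Subgroup ↥N) (hmono : Monotone Nj) (hc : ∀ j, IsCompact (Nj j : Set ↥N)) (ho : ∀ j, IsOpen (Nj j : Set ↥N))
    (hex : ∀ n : ↥N, ∃ j, n ∈ Nj j) (x y : G) (u u' : V) :
    ∫ n : ↥N, B u' (ρ (x * n * y) u) ∂μ = 0 :=
  integral_sesqForm_apply_translate_eq_zero ρ N μ hsm hJ Nj hmono hc ho hex x y u u'
    (integrable_sesqForm_apply_translate_restrict ρ N μ hsc hZ hsm hBinv hN x y u u')

/-- **HEAD (conjugate-linear slot, `B` Hermitian)**: `∀ x y u u', ∫_N B (ρ(x n y) u) u' dμ = 0` for supercuspidal `ρ`, compact centre, closed exhausted `N`, Jacquet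
vanishing. [cite: HarishChandra1970, Part I §3 p. 9] [cite: Casselman1995, Thm. 5.3.1] -/
theorem integral_sesqForm_translate_apply_eq_zero_of_isSupercuspidal (hsc : ρ.IsSupercuspidal) (hZ : IsCompact (Subgroup.center G : Set G))
    (hsm : ρ.IsSmooth) (hBsymm : B.IsSymm) (hBinv : ∀ (g : G) (v w : V), B (ρ g v) (ρ g w) = B v w) (hN : IsClosed (N : Set G))
    (hJ : ∀ w : V, w ∈ Submodule.span ℂ (Set.range fun p : ↥N × V => ρ (p.1 : G) p.2 - p.2))
    (Nj : ℕ → Subgroup ↥N) (hmono : Monotone Nj) (hc : ∀ j, IsCompact (Nj j : Set ↥N)) (ho : ∀ j, IsOpen (Nj j : Set ↥N))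
    (hex : ∀ n : ↥N, ∃ j, n ∈ Nj j) (x y : G) (u u' : V) :
    ∫ n : ↥N, B (ρ (x * n * y) u) u' ∂μ = 0 :=
  integral_sesqForm_translate_apply_eq_zero ρ N μ hsm hBsymm hJ Nj hmono hc ho hex x y u u'
    (integrable_sesqForm_apply_translate_restrict ρ N μ hsc hZ hsm hBinv hN x y u u')

/-- **THE DEALT COROLLARY — the normalised idempotent is `N`-cuspidal.**  For any test function `e : G → ℂ` with `e g = c · B (ρ g u) u` (K2E1-p06 (g2)'s ★ p855188
`K2E1SupercuspidalIdempotent`: `e = λ⁻¹ B(ρ(·)u) u`, a self-adjoint idempotent of `C_c(G)` detecting `ρ`): `∀ x y, ∫_N e(x n y) dμ(n) = 0`.  This is the hypothesis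
`hcusp` of ★ p855202 `K2E1PoincareSeriesConstantTerm.setIntegral_tsum_eq_zero_of_forall_integral_eq_zero` (ii), read on the subgroup `N`.
[cite: HarishChandra1970, Part I §3 p. 9] [cite: Gelbart1975, §10 p. 153 (10.11)] [cite: Rogawski1990, §13.8 p. 218 (i)–(iii)] -/
theorem integral_idempotent_translate_eq_zero (hsc : ρ.IsSupercuspidal) (hZ : IsCompact (Subgroup.center G : Set G))
    (hsm : ρ.IsSmooth) (hBsymm : B.IsSymm) (hBinv : ∀ (g : G) (v w : V), B (ρ g v) (ρ g w) = B v w) (hN : IsClosed (N : Set G))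
    (hJ : ∀ w : V, w ∈ Submodule.span ℂ (Set.range fun p : ↥N × V => ρ (p.1 : G) p.2 - p.2))
    (Nj : ℕ → Subgroup ↥N) (hmono : Monotone Nj) (hc : ∀ j, IsCompact (Nj j : Set ↥N)) (ho : ∀ j, IsOpen (Nj j : Set ↥N))
    (hex : ∀ n : ↥N, ∃ j, n ∈ Nj j) {u : V} {c : ℂ} {e : G → ℂ} (he : ∀ g, e g = c * B (ρ g u) u) (x y : G) :
    ∫ n : ↥N, e (x * n * y) ∂μ = 0 := by
  simp_rw [he]
  rw [integral_const_mul, integral_sesqForm_translate_apply_eq_zero_of_isSupercuspidal ρ N μ hsc hZ hsm hBsymm hBinv hN hJ Nj hmono hc ho hex x y u u,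
    mul_zero]

end Generic

/-! ## §2 The reading on `G_v = U(Φ_N)(L⁺_v)`, `N_v` = the unipotent radical of the upper-triangular Borel (★ `cmBorelTriple`) -/

section Unitary

open NumberField IsDedekindDomain Literature.NumberTheory.Automorphic.UnitaryGroup

variable (L : Type) [Field L] [NumberField L] [IsCMField L] (N : ℕ) (v : HeightOneSpectrum (𝓞 ↥(maximalRealSubfield L)))

/-- **`N_v` is CLOSED in `U(Φ_N)(L⁺_v)`, every `N`**: the radical `(cmBorelTriple L N v).N = unipotentU` is the pull-back of the closed upper-unitriangular
matrices (★ `isClosed_upperUnitriangular`) under the continuous inclusion `U ↪ GL_N` (the tree's ★ `UnitaryGroup.isClosed_cmBorelTriple_N`,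
`CMBorelUnipotentIndexModulus`, is the case `N = 3`; same one-line proof). [cite: Rogawski1990, §1.10 p. 9] -/
theorem _root_.Literature.NumberTheory.Automorphic.UnitaryGroup.isClosed_coe_cmBorelTriple_N :
    IsClosed ((cmBorelTriple L N v).N : Set ↥(unitaryGroupOfForm (conjLocal L (IsCMField.complexConj L) v) (cmLocalForm L N v))) :=
  (isClosed_upperUnitriangular (n := N) (R := LocalRing L v)).preimage continuous_subtype_val

/-- **`U(Φ_N)(L⁺_v)` READING — the normalised supercuspidal idempotent is `N_v`-cuspidal.**  `G_v = ↥(unitaryGroupOfForm (conjLocal L c v) (cmLocalForm L N v))`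
(= `(cmDatum L N Φ_N).Local v`, ★ `cmDatum_Local_eq`), `N_v = (cmBorelTriple L N v).N` with a right-invariant measure `μ` finite on compacta; `ρ₀` smooth
SUPERCUSPIDAL with a `G_v`-invariant Hermitian form `B`; HYPOTHESES carried explicitly (★ for `N = 3`: `UnitaryGroup.coinvariants_subsingleton_of_isSupercuspidal`,
`exists_compactOpen_subgroups_exhausting_unipotentU_three`; for `N = 2` the two remaining local letters of 5R route S2): compact centre `hZ`, Jacquet vanishing
`hJ`, exhaustion `Nj`.  Then `e = c · B(ρ₀(·)u) u` satisfies `∀ x y, ∫_{N_v} e(x n y) dμ = 0`. [cite: HarishChandra1970, Part I §3 p. 9] [cite: Rogawski1990, §12.2 p. 173, §13.8 p. 218 (i)–(iii)] -/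
theorem _root_.Literature.NumberTheory.Automorphic.UnitaryGroup.integral_idempotent_translate_cmBorelN_eq_zero
    [MeasurableSpace ↥(cmBorelTriple L N v).N] [BorelSpace ↥(cmBorelTriple L N v).N]
    (μ : Measure ↥(cmBorelTriple L N v).N) [IsFiniteMeasureOnCompacts μ] [μ.IsMulRightInvariant]
    {V : Type*} [AddCommGroup V] [Module ℂ V]
    (ρ₀ : Representation ℂ ↥(unitaryGroupOfForm (conjLocal L (IsCMField.complexConj L) v) (cmLocalForm L N v)) V)
    {B : V →ₗ⋆[ℂ] V →ₗ[ℂ] ℂ} (hsc : ρ₀.IsSupercuspidal)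
    (hZ : IsCompact (Subgroup.center ↥(unitaryGroupOfForm (conjLocal L (IsCMField.complexConj L) v) (cmLocalForm L N v)) :
      Set ↥(unitaryGroupOfForm (conjLocal L (IsCMField.complexConj L) v) (cmLocalForm L N v))))
    (hsm : ρ₀.IsSmooth) (hBsymm : B.IsSymm) (hBinv : ∀ g (x w : V), B (ρ₀ g x) (ρ₀ g w) = B x w)
    (hJ : ∀ w : V, w ∈ Submodule.span ℂ (Set.range fun p : ↥(cmBorelTriple L N v).N × V => ρ₀ (p.1 : _) p.2 - p.2))
    (Nj : ℕ → Subgroup ↥(cmBorelTriple L N v).N) (hmono : Monotone Nj) (hc : ∀ j, IsCompact (Nj j : Set ↥(cmBorelTriple L N v).N))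
    (ho : ∀ j, IsOpen (Nj j : Set ↥(cmBorelTriple L N v).N)) (hex : ∀ n : ↥(cmBorelTriple L N v).N, ∃ j, n ∈ Nj j)
    {u : V} {c : ℂ} {e : ↥(unitaryGroupOfForm (conjLocal L (IsCMField.complexConj L) v) (cmLocalForm L N v)) → ℂ} (he : ∀ g, e g = c * B (ρ₀ g u) u)
    (x y : ↥(unitaryGroupOfForm (conjLocal L (IsCMField.complexConj L) v) (cmLocalForm L N v))) :
    ∫ n : ↥(cmBorelTriple L N v).N, e (x * n * y) ∂μ = 0 :=
  haveI : T2Space ↥(unitaryGroupOfForm (conjLocal L (IsCMField.complexConj L) v) (cmLocalForm L N v)) := inferInstance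
  integral_idempotent_translate_eq_zero ρ₀ (cmBorelTriple L N v).N μ hsc hZ hsm hBsymm hBinv (isClosed_coe_cmBorelTriple_N L N v) hJ Nj hmono hc ho hex he x y

end Unitary

end Summit.HodgeConjecture.HodgeConjecture.Cruxes.H413.K2E1SupercuspidalCoefficientNCuspidal

end
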